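import Literature.MathematicalPhysics.QuantumFieldTheory.ConstructiveQFTWave0Proofs
import HarnessLib

/-!
# Reflection positivity of the Wilson lattice gauge theory for covariant observables

Theorem-only companion of `ConstructiveQFTWave0Proofs` (Osterwalder–Seiler reflection positivity
of the torus Wilson measure for the reflection `θ t = 1 - t` in the hyperplanes between time
slices, `wilsonExpectation_reflectionPositive_holds`). That theorem is stated for observables of
the positive-time half `Λ₊` which do not touch the temporal links CROSSING the reflection
hyperplanes. Gauge-invariant loop observables bisected by the hyperplane — the rectangular Wilson
loops `W(R, 2s+1)` of odd time extent, as needed for the transfer-matrix bound on the static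
potential (Seiler LNP 159 §2) — necessarily contain the two crossing links. The proof in
`ConstructiveQFTWave0Proofs` in fact handles such observables: after the substitution
`WilsonRP.translate Y` splitting the crossing link variables (`U_e ↦ U_e Y_e` below,
`U_e ↦ Y_e U_e` above), an observable `Φ` is admissible as soon as
`Φ (translate Y U) = ∑ₖ gₖ(z) conj gₖ(Θ U)`, `z = splice_C(U, Y)`, for finitely many bounded
measurable `gₖ` depending only on the positive and crossing links `P ∪ C` — this is the
"covariant" form a Wilson loop takes, with `gₖ` the matrix entries of
`σ(Y_{e₀}) σ(staple) σ(Y_{e_R})⁻¹`. This file proves that extension, reusing the bookkeeping of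
the namespace `WilsonRP` verbatim:

* `WilsonRP.covIntegrand_translate`: the pointwise identity for `e^{-β S} Φ` after the
  substitution;
* `WilsonRP.integral_covIntegrand_nonneg`: `0 ≤ ∫ e^{-β S} Φ ∏ dU_e`;
* `wilsonExpectation_nonneg_of_covariant`: `0 ≤ ⟨Φ⟩_{Λ,β}` (even `L`, `β ≥ 0`, continuous `ρ`).

References: K. Osterwalder, E. Seiler, Ann. Phys. 110 (1978) 440, §2; E. Seiler, LNP 159
(1982), Ch. 2 (physical positivity and Wilson loops). All statements here are proved. [folklore]
-/

open MeasureTheory Finset Complex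
open scoped ComplexOrder ENNReal ComplexConjugate

namespace Literature.MathematicalPhysics.QuantumFieldTheory

noncomputable section

namespace WilsonRP

variable {d L N : ℕ} [NeZero d] [NeZero L] [Fact (1 < L)]
variable {G : Type*} [Group G] [TopologicalSpace G] [IsTopologicalGroup G] [CompactSpace G]
  [MeasurableSpace G] [BorelSpace G]
variable (ρ : G →* Matrix (Fin N) (Fin N) ℂ)

omit [TopologicalSpace G] [IsTopologicalGroup G] [CompactSpace G] [MeasurableSpace G]
  [BorelSpace G] in
/-- `g · exp(β A)` depends only on the links in `P ∪ C` if `g` does. [folklore] -/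
theorem dependsOn_gObs_of_union (β : ℝ) {F : GaugeConfig d L G → ℂ}
    (hFdep : DependsOn F ((posEdges ∪ crossEdges : Finset (Edge d L)) : Set (Edge d L))) :
    DependsOn (gObs ρ β F) ((posEdges ∪ crossEdges : Finset (Edge d L)) : Set (Edge d L)) := by
  intro U V hUV
  have h : ∀ e ∈ ((posEdges : Finset (Edge d L)) : Set (Edge d L)), U e = V e := fun e he =>
    hUV e (by rw [Finset.coe_union]; exact Or.inl he)
  simp only [gObs, hFdep hUV, dependsOn_posAction ρ h]

omit [MeasurableSpace G] [BorelSpace G] in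
/-- **The pointwise identity for covariant observables**: if
`Φ (translate Y U) = ∑ₖ gₖ(z) conj gₖ(ΘU)` then after the substitution `translate Y` the integrand
is `∑ₖ e^{-βN#plaq} (gₖ e^{βA})(z) conj (gₖ e^{βA})(ΘU) exp(∑ᵢ aᵢ(z) conj aᵢ(ΘU))`,
`z = splice_C(U, Y)`. [folklore] -/
theorem covIntegrand_translate (hL : Even L) (hρ : Continuous ρ) {β : ℝ} (hβ : 0 ≤ β)
    {K : Type*} [Fintype K] {g : K → GaugeConfig d L G → ℂ} {Φ : GaugeConfig d L G → ℂ}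
    (hcov : ∀ U Y, Φ (translate Y U) =
      ∑ k, g k (LatticeRP.splice crossEdges (U, Y)) * conj (g k U.timeReflect))
    (U Y : GaugeConfig d L G) :
    (Real.exp (-β * wilsonAction ρ (translate Y U)) : ℂ) * Φ (translate Y U) =
      ∑ k, rpIntegrand₂ ρ hρ β (g k) (U, Y) := by
  have hPC : ∀ e : Edge d L, IsPosEdge e → ¬ IsCrossEdge e :=
    fun e he hc => not_isPosEdge_of_isCrossEdge hL hc he
  have hmem : ∀ e : Edge d L, e ∈ ((posEdges : Finset (Edge d L)) : Set (Edge d L)) →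
      IsPosEdge e := fun e he => by simpa using he
  have htr : ∀ e ∈ ((posEdges : Finset (Edge d L)) : Set (Edge d L)), translate Y U e = U e :=
    fun e he => translate_apply_of_not_isCrossEdge Y U (hPC e (hmem e he))
  have hsp : ∀ e ∈ ((posEdges : Finset (Edge d L)) : Set (Edge d L)),
      LatticeRP.splice crossEdges (U, Y) e = U e :=
    fun e he => splice_apply_of_not_isCrossEdge U Y (hPC e (hmem e he))
  have hΘtr : ∀ e ∈ ((posEdges : Finset (Edge d L)) : Set (Edge d L)),
      (translate Y U).timeReflect e = U.timeReflect e := by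
    intro e he
    rw [timeReflect_apply, timeReflect_apply,
      translate_apply_of_not_isCrossEdge Y U (not_isCrossEdge_edgeReflect hL (hmem e he))]
  have hA1 : posAction ρ (translate Y U) = posAction ρ U := dependsOn_posAction ρ htr
  have hA2 : posAction ρ (translate Y U).timeReflect = posAction ρ U.timeReflect :=
    dependsOn_posAction ρ hΘtr
  have hA3 : posAction ρ (LatticeRP.splice crossEdges (U, Y)) = posAction ρ U :=
    dependsOn_posAction ρ hsp
  rw [hcov, wilsonAction_split ρ hL hρ, hA1, hA2, Finset.mul_sum]
  refine Finset.sum_congr rfl fun k _ => ?_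
  unfold rpIntegrand₂ gObs
  rw [sum_coeff_mul_conj ρ hL hρ hβ, hA3, ← Complex.ofReal_exp]
  simp only [map_mul, Complex.conj_ofReal]
  rw [show -β * (↑N * ↑(Fintype.card (Plaquette d L)) -
        (posAction ρ U + posAction ρ U.timeReflect + crossAction ρ (translate Y U))) =
      -β * (↑N * ↑(Fintype.card (Plaquette d L))) + β * posAction ρ U +
        β * posAction ρ U.timeReflect + β * crossAction ρ (translate Y U) by ring,
    Real.exp_add, Real.exp_add, Real.exp_add]
  push_cast
  ring

omit [NeZero d] [Fact (1 < L)] [CompactSpace G] in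
/-- The integrand `exp(-β S) Φ` is measurable. [folklore] -/
theorem measurable_covIntegrand (hρ : Continuous ρ) (β : ℝ) {Φ : GaugeConfig d L G → ℂ}
    (hΦ : Measurable Φ) :
    Measurable fun U : GaugeConfig d L G => (Real.exp (-β * wilsonAction ρ U) : ℂ) * Φ U :=
  (Complex.measurable_ofReal.comp ((measurable_wilsonAction ρ hρ).const_mul (-β)).exp).mul hΦ

/-- **Reflection positivity of the un-normalised Wilson weight for covariant observables**:
`0 ≤ ∫ exp(-β S(U)) Φ(U) ∏ dU_e` whenever `Φ (translate Y U) = ∑ₖ gₖ(splice_C(U,Y)) conj gₖ(ΘU)`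
for bounded measurable `gₖ` depending only on the links in `P ∪ C`. [folklore] -/
theorem integral_covIntegrand_nonneg (hL : Even L) (hρ : Continuous ρ) {β : ℝ} (hβ : 0 ≤ β)
    {K : Type*} [Fintype K] {g : K → GaugeConfig d L G → ℂ} (hgm : ∀ k, Measurable (g k))
    {Kg : ℝ} (hgb : ∀ k U, ‖g k U‖ ≤ Kg)
    (hgdep : ∀ k, DependsOn (g k) ((posEdges ∪ crossEdges : Finset (Edge d L)) : Set (Edge d L)))
    {Φ : GaugeConfig d L G → ℂ} (hΦm : Measurable Φ)
    (hcov : ∀ U Y, Φ (translate Y U) =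
      ∑ k, g k (LatticeRP.splice crossEdges (U, Y)) * conj (g k U.timeReflect)) :
    0 ≤ ∫ U, (Real.exp (-β * wilsonAction ρ U) : ℂ) * Φ U ∂(LatticeRP.piMeasure (haarProbability G)) := by
  set μ : Measure (GaugeConfig d L G) := LatticeRP.piMeasure (haarProbability G) with hμ
  set H : GaugeConfig d L G → ℂ := fun U => (Real.exp (-β * wilsonAction ρ U) : ℂ) * Φ U with hH
  have hHm : Measurable H := measurable_covIntegrand ρ hρ β hΦm
  have hR : ∀ U Y, H (translate Y U) = ∑ k, rpIntegrand₂ ρ hρ β (g k) (U, Y) :=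
    fun U Y => covIntegrand_translate ρ hL hρ hβ hcov U Y
  have hRi : ∀ k, Integrable (rpIntegrand₂ ρ hρ β (g k)) (μ.prod μ) := fun k =>
    Integrable.of_bound (measurable_rpIntegrand₂ ρ hρ β (hgm k)).aestronglyMeasurable _
      (ae_of_all _ (norm_rpIntegrand₂_le ρ hρ hβ (hgb k)))
  have step1 : ∫ U, H U ∂μ =
      ∫ Y, ∫ U, ∑ k, rpIntegrand₂ ρ hρ β (g k) (U, Y) ∂μ ∂μ := by
    have hY : ∀ Y, ∫ U, H U ∂μ =
        ∫ U, ∑ k, rpIntegrand₂ ρ hρ β (g k) (U, Y) ∂μ := fun Y => by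
      rw [← LatticeRP.integral_comp_eq_of_measurePreserving (measurePreserving_translate Y) hHm]
      exact integral_congr_ae (ae_of_all _ fun U => hR U Y)
    calc ∫ U, H U ∂μ = ∫ _Y, (∫ U, H U ∂μ) ∂μ := by
          rw [integral_const, probReal_univ, one_smul]
      _ = ∫ Y, ∫ U, ∑ k, rpIntegrand₂ ρ hρ β (g k) (U, Y) ∂μ ∂μ :=
          integral_congr_ae (ae_of_all _ hY)
  have hsum : Integrable (fun p : GaugeConfig d L G × GaugeConfig d L G =>
      ∑ k, rpIntegrand₂ ρ hρ β (g k) p) (μ.prod μ) :=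
    integrable_finsetSum _ fun k _ => hRi k
  rw [step1, ← integral_prod_symm _ hsum, integral_finsetSum _ fun k _ => hRi k]
  refine Finset.sum_nonneg fun k _ => ?_
  unfold rpIntegrand₂
  rw [integral_const_mul]
  refine mul_nonneg (Complex.zero_le_real.2 (Real.exp_pos _).le) ?_
  exact LatticeRP.integral_mul_conj_mul_exp_nonneg (haarProbability G) posEdges crossEdges
    GaugeConfig.timeReflect measurePreserving_timeReflect
    (fun e he => dependsOn_timeReflect_apply hL e he) (measurable_gObs ρ hρ β (hgm k))
    (fun i => measurable_coeff ρ hρ β i) (norm_gObs_le ρ hρ hβ (hgb k))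
    (fun i U => norm_coeff_le ρ hρ β i U) (dependsOn_gObs_of_union ρ β (hgdep k))
    (fun i => dependsOn_coeff ρ hL hρ β i)

end WilsonRP

/-! ## The theorem for covariant observables -/

section Main

variable {d L N : ℕ} {G : Type*} [Group G] [TopologicalSpace G] [IsTopologicalGroup G]
  [CompactSpace G] [MeasurableSpace G] [BorelSpace G] (ρ : G →* Matrix (Fin N) (Fin N) ℂ)

/-- **Osterwalder–Seiler reflection positivity for covariant observables** (torus `(ℤ/Lℤ)^d`,
`L` even, reflection `θ t = 1 - t` in the hyperplanes between time slices, continuous `ρ`,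
`β ≥ 0`; Osterwalder–Seiler, Ann. Phys. 110 (1978) 440, §2; Seiler LNP 159 Ch. 2). If a
measurable observable `Φ` satisfies, for all configurations `U, Y`,
`Φ (translate Y U) = ∑ₖ gₖ(splice_C(U, Y)) · conj gₖ(Θ U)` for finitely many bounded measurable
`gₖ` depending only on the positive-time and crossing links (`WilsonRP.posEdges ∪
WilsonRP.crossEdges`), then `⟨Φ⟩_{Λ,β} ≥ 0` (real and non-negative). For `Φ = conj F(ΘU) F(U)`
with `F` a positive-time observable this is `wilsonExpectation_reflectionPositive` (`gₖ = F`);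
the Wilson loops of odd time extent bisected by the hyperplane are of this form with `gₖ` the
matrix entries of `σ(Y_{e}) σ(hol staple) σ(Y_{e'})⁻¹`. [folklore] -/
theorem wilsonExpectation_nonneg_of_covariant [NeZero d] [NeZero L]
    (hL : Even L) (hρ : Continuous ρ) {β : ℝ} (hβ : 0 ≤ β)
    {K : Type*} [Fintype K] {g : K → GaugeConfig d L G → ℂ} (hgm : ∀ k, Measurable (g k))
    {Kg : ℝ} (hgb : ∀ k U, ‖g k U‖ ≤ Kg)
    (hgdep : ∀ k, DependsOn (g k)
      ((WilsonRP.posEdges ∪ WilsonRP.crossEdges : Finset (Edge d L)) : Set (Edge d L)))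
    {Φ : GaugeConfig d L G → ℂ} (hΦm : Measurable Φ)
    (hcov : ∀ U Y, Φ (WilsonRP.translate Y U) =
      ∑ k, g k (LatticeRP.splice WilsonRP.crossEdges (U, Y)) * conj (g k U.timeReflect)) :
    0 ≤ wilsonExpectation ρ β Φ := by
  haveI : Fact (1 < L) := ⟨by
    obtain ⟨r, hr⟩ := hL
    have := NeZero.ne L
    omega⟩
  have hdens : Measurable fun U : GaugeConfig d L G =>
      ENNReal.ofReal (Real.exp (-β * wilsonAction ρ U)) :=
    ENNReal.measurable_ofReal.comp ((WilsonRP.measurable_wilsonAction ρ hρ).const_mul (-β)).exp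
  unfold wilsonExpectation wilsonMeasure
  rw [integral_smul_measure]
  unfold wilsonWeight
  rw [integral_withDensity_eq_integral_toReal_smul hdens (ae_of_all _ fun _ => ENNReal.ofReal_lt_top)]
  simp_rw [ENNReal.toReal_ofReal (Real.exp_nonneg _), Complex.real_smul]
  refine mul_nonneg (Complex.zero_le_real.2 ENNReal.toReal_nonneg) ?_
  exact WilsonRP.integral_covIntegrand_nonneg ρ hL hρ hβ hgm hgb hgdep hΦm hcov

end Main

end

end Literature.MathematicalPhysics.QuantumFieldTheory
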